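import Mathlib
import HarnessLib
import HarnessLib.Audit
import Summits.ResolutionOfSingularities.Statement
import Literature.AlgebraicGeometry.Motives.Varieties
import Literature.AlgebraicGeometry.Resolution.Blowups
import Literature.AlgebraicGeometry.Resolution.BlowupsProperProofs
import Literature.AlgebraicGeometry.Resolution.ComponentGluing
import HarnessLib.Audit.Status.Attr

/-!
Route: EquisingularLift

# Route EquisingularLift — lift the hypersurface to characteristic 0; resolve there; specialise the
regular horizontal centres

It suffices to show, for every prime p, X = EL_p ∧ HS together with the Descent chain shared with
route Descent (DescentAlgclosedToPerfect stmt-0550, DescentPerfectToAll stmt-0549). EL_p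
(EQUISINGULAR LIFT, crux rank 2): every integral HYPERSURFACE H of a projective space over an
ALGEBRAICALLY CLOSED field k of characteristic p (closed, locally principal ideal) sits, up to
isomorphism, as a reduced closed subset Y of the special fibre of a SMOOTH PROPER scheme P over a
discrete valuation ring O OF CHARACTERISTIC ZERO (mixed characteristic (0,p)), such that a finite
sequence of blow-ups of P in REGULAR centres lying off the generic point of Y (typed since rev 1 as
the induction principle of the tree inductive IsEmbeddedTransform — equivalent to it, planner probe
chain_iff rc 0 — so that the route file imports only Resolution.Blowups), ALL HORIZONTAL (typed as:
the special fibre of the blown-up ambient P' is still irreducible, i.e. no centre has a vertical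
component, so every centre is the O-flat closure of a characteristic-0 regular centre), has REGULAR
reduced strict transform of Y. HS (HYPERSURFACES SUFFICE, crux rank 4, rev 2 = rev-1
HypersurfaceModels composed with the reduced ⇒ integral-projective reduction): over an algebraically
closed field k, resolution of every integral hypersurface H ⊆ P^m_k (closed, locally principal
ideal) implies resolution of every reduced separated k-scheme of finite type (irreducible
components, Chow's lemma, projective closure — IN TREE verbatim as
Theorems.WeightedThesis.ProjectiveIntegralSuffices.stub_projectiveIntegralSuffices — then a generic
linear projection X → P^{dim X+1}, finite and birational onto its hypersurface image, and transfer
of a resolution back through the normal source; classical). Cards realised: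
p-adic-equisingular-lifting (spine: 'resolve in characteristic 0 and specialise, choosing the
lift'), ramified-coalescence-weights (its ramified conjugate centres are exactly the horizontal
regular centres with NON-REDUCED special fibre allowed here).
Lean: `EquisingularLift ∧ HypersurfacesSuffice ∧ DescentAlgclosedToPerfect ∧ DescentPerfectToAll`

## Assembly
Rev 2 (crux-only deciding theorem, human ruling 2026-08-16): `closes : EquisingularLift →
HypersurfacesSuffice → DescentAlgclosedToPerfect → DescentPerfectToAll → ResolutionOfSingularities`
is PROVED sorry-free in the route file (axioms propext / Classical.choice / Quot.sound; planner
Sketch.lean rc 0), with imports Mathlib + Summits.ResolutionOfSingularities.Statement +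
Literature.AlgebraicGeometry.Motives.Varieties + Literature.AlgebraicGeometry.Resolution.Blowups +
Literature.AlgebraicGeometry.Resolution.BlowupsProperProofs (IsBlowup.isProper: blow-ups of locally
Noetherian schemes are proper, the named facts Stacks02NS / AffineBlowupIsBlowup being DISCHARGED
there) + Literature.AlgebraicGeometry.Resolution.ComponentGluing
(isIntegral_subscheme_vanishingIdeal) — an import closure that declares no unproved named fact
beyond the Statement file's own (ResolutionOfSingularities = the summit, CossartPiltant2019). The
two rev-1 support items are gone: ProjectiveIntegralSuffices is absorbed into the crux
HypersurfacesSuffice, and EmbeddedTransformResolves (embedded desingularisation ⇒ resolution, BGMW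
2011 §3.3 (3)⇒(4)) is proved INSIDE `closes`. The proof: fix a prime p; DescentPerfectToAll reduces
ResolutionInChar p to perfect fields, DescentAlgclosedToPerfect to algebraically closed k,
HypersurfacesSuffice to integral hypersurfaces H ⊆ P^m_k; EquisingularLift gives (O, P, P', q, Y, σ,
S') and e : V(Y) ≅ H; ι₀ := e⁻¹ ≫ (V(Y) ↪ P) is a closed immersion of the integral H into the
locally Noetherian P (smooth over a DVR) with range Y, whose generic point ξ is THE generic point of
Y, so no centre lies over it; the induction principle of the blow-up chain, applied to the motive
'σ' is proper, an isomorphism over an open V ⊇ {generic points of Y}, and the strict transform is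
the closure of the unique point over ξ' (each blow-up is proper — IsBlowup.isProper — and an
isomorphism off its centre — IsBlowup.isIso_morphismRestrict; three folklore lemmas on morphisms
that are isomorphisms over an open, inlined), yields σ proper, V ∋ ξ with σ|_V an isomorphism and S'
= closure {ξ'}; the reduced closed subscheme Z~ on closure S' is integral, σ ∘ (Z~ ↪ P') factors
through ι₀ (IsClosedImmersion.lift) as ρ : Z~ → H, which is proper, birational (a surjective closed
immersion onto the reduced ι₀⁻¹ V, dense on both sides) and has regular source by hypothesis:
HasResolution H. This is the argument of Literature hasResolution_of_isEmbeddedTransform /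
IsEmbeddedTransform.isProper_and_exists (EmbeddedResolution.lean), re-proved inline because that
file's import cone carries 16 unproved named facts. The Assembly item below is the same implication
as a statement (closable at once by `closes`).

Rationale: WHY THIS LINE. Operator adjacent-transfer. The SOLVED siblings: (i) dimension one of the same
statement — every plane curve singularity over an algebraically closed field of characteristic p has
an equisingular characteristic-0 model (Campillo1980) and, by Ishii2025 Thm 1.1/Cor 1.5
(arXiv:2506.23533, 'skeleton lifting'), a LIFT whose successive point blow-ups (sections over the
base: horizontal regular centres) carry the same multiplicity data at every stage, i.e. EL_p holds
for n = 2; (ii) Teissier singularities in every dimension (MourtadaSchober2025 = arXiv:2502.01239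
Thm 1.3: an equisingular family over O_{C_p} with quasi-ordinary characteristic-0 generic fibre,
embedded simultaneous resolution); (iii) rational double points (Artin1977: every char-p RDP lifts
with its Dynkin type); (iv) characteristic 0 itself (Hironaka1964 / Kollar2007 Thm 3.36 /
AbramovichTemkinWlodarczyk2024: canonical embedded resolution of the generic fibre — the engine
upstairs). Dictionary: char-p hypersurface H ↦ special fibre of a flat lift over a char-0 DVR;
resolution centre C_i ↦ special fibre of the flat closure of a char-0 regular centre; Enriques
diagram / multiplicity sequence ↦ Hironaka's resolution datum of the generic fibre;
characteristic-free constancy of the colength of complete ideals of infinitely near points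
(Hoskin–Deligne, dimension 2; Campillo1980, Ishii2025 §4) ↦ flat specialisation of the strict
transforms. WHAT BREAKS going up: (a) Kollar2026 (arXiv:2603.04211, via Ishii2025 Rem 4.3) — for N ≥
3 the valuative version of skeleton lifting fails; (b) distinct K-rational char-0 centres may
COLLIDE in the special fibre (closure not regular), the 'coalescence' of card
ramified-coalescence-weights, while conjugate centres over a ramified O' are harmless (their closure
Spec O'[t]/(t^e-π) IS regular, with non-reduced special fibre — a weighted-looking char-p centre
produced, not posited); (c) kangaroo points (Moh1987, HauserPerlega2019) have no char-0 singularity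
of equal complexity, so the lift must be chosen 'most singular' over ramified O' (card
p-adic-equisingular-lifting: the jump is the reduction of a p-adically small coefficient); (d)
globally, singular configurations special to characteristic p may be superabundant. The crux EL_p is
exactly the repair: existence of SOME lift and SOME horizontal regular-centre sequence. Why easier
than the summit although EL_p implies embedded resolution of hypersurfaces over kbar: the centres
need not be invented in characteristic p — for an equisingular lift they are the closures of
canonical characteristic-0 centres, and what must be proved is flat regular specialisation,
attackable by upper semicontinuity of Hilbert–Samuel functions on the excellent total space
(Bennett1970), Zariski–Campillo equisingularity, Artin approximation and p-adic ramification
bookkeeping; no hypersurface of maximal contact, no characteristic-p invariant, no valuation, no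
alteration is used. Imported areas: arithmetic geometry of models over DVRs (mixed characteristic),
equisingularity theory, p-adic fields. No open or draft route lifts to characteristic 0:
MarkedTransfer ports the char-0 ALGORITHM into char p (Hasse–Schmidt derivatives),
Descent/UniformComplexity move the ground field inside characteristic p, WeightedInvariant posits a
char-p invariant, the others use covers, valuations, alterations, Frobenius or universality.

RANKED CRUXES. #2 EquisingularLift (crux) — for every prime p, every algebraically closed k of char
p, every n and every integral closed H ⊆ P^n_k with locally principal ideal: there are a DVR O of
characteristic 0, a smooth proper q : P → Spec O, a closed subset Y of P inside the special fibre
whose reduced induced subscheme is isomorphic to H, and a composite σ : P' → P of blow-ups in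
regular centres lying over {x | x is not a generic point of Y}, with its iterated strict transform
S' (the tree inductive IsEmbeddedTransform, inlined since rev 1 as its induction principle — 'every
class of triples (X', X' → P, subset) containing (P, id, Y) and closed under one more blow-up in a
regular centre over that set, with strict transform the closure of the preimage of the complement of
the centre, contains (P', σ, S')' — equivalent to it, planner probe chain_iff rc 0), such that the
special fibre of P' → Spec O is IRREDUCIBLE (all centres horizontal) and the reduced closed
subscheme on the closure of the iterated strict transform of Y is regular (cards
p-adic-equisingular-lifting D1, ramified-coalescence-weights Crux 1). [difficulty: open-problem]
(why it might fail: a char-p singular locus can exceed every lift's (Kollar2026 via Ishii2025 Rem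
4.3; kangaroo points HauserPerlega2019): distinct char-0 centres may be forced to collide in the
special fibre, whose closure is then not regular — vertical un-colliding blow-ups are excluded by
the typing.) [Ishii2025, MourtadaSchober2025, Kollar2026, Campillo1980, Artin1977,
HauserPerlega2019, Bennett1970]
#4 HypersurfacesSuffice (crux; rev 2 = rev-1 HypersurfaceModels ∘ the dropped support
ProjectiveIntegralSuffices) — over an algebraically closed field k (any characteristic): if every
integral closed H ⊆ P^m_k with locally principal ideal (a hypersurface) has a resolution of
singularities, then so does every reduced separated k-scheme of finite type (reduced ⇒ integral
closed subschemes of P^n: irreducible components with the reduced structure, Chow's lemma in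
integral form, projective closure, transport along open immersions and proper birational morphisms —
IN TREE verbatim as
Theorems.WeightedThesis.ProjectiveIntegralSuffices.stub_projectiveIntegralSuffices,
CossartPiltant2019 Prop 4.6 Steps 1–3; integral X ⊆ P^n ⇒ hypersurface model: generic linear
projection X → P^{dim X+1}, finite and birational onto its closed image H because k(X)/k is
separably generated (k perfect), Hartshorne1977 I.4.9; a resolution of H is regular hence normal, so
it factors through X — integral over H inside k(H) = k(X) — and resolves X; tree:
WeightedThesis.FiniteBirationalTransfer LANDED, HypersurfaceModel{Image,Projection,FieldCore}
landing). [difficulty: L] (why it might fail: only if mis-typed: birationality of a generic LINEAR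
projection needs k(X)/k separably generated (true, k perfect) and the image taken CLOSED in P^{d+1}
with locally principal ideal on all of P^{d+1}; the reduced ⇒ integral-projective half is a tree
theorem.) [Hartshorne1977, Kollar2007, CossartPiltant2019, StacksProject]
#5 DescentAlgclosedToPerfect (crux) — shared verbatim with route Descent stmt-0550: for a prime p,
resolution of all reduced separated finite-type schemes over all algebraically closed fields of char
p implies the same over all perfect fields of char p. [difficulty: L] (why it might fail: print gets
kbar ⇒ perfect k only for Galois-EQUIVARIANT resolutions (BGMW2011 Remark; Kollar2007 Thm 3.36);
from bare existence the Galois-symmetrised fibre product is singular; false if some X over F_q has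
no Gal-stable resolution.) [Kollar2007, arXiv:1206.3090,
Literature.Barriers.ResolutionOfSingularities.InseparableBaseChange]
#6 DescentPerfectToAll (crux) — shared verbatim with route Descent stmt-0549: for a prime p,
resolution over all perfect fields of char p (reduced separated finite type) implies
ResolutionInChar p. [difficulty: open-problem] (why it might fail: regular is not geometrically
regular under inseparable ground-field extension (EGA IV 6.7.4); spreading out needs k/K0 separable,
impossible beyond the p-rank (MacLane; k = F_p((t))).) [arXiv:math/0703678, CossartPiltant2019,
Literature.Barriers.ResolutionOfSingularities.InseparableBaseChange]

TWO-LAYER PLAN. EquisingularLift ⇐ LocalEquisingularLift (germs: complete local hypersurfaces over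
kbar, where the interpolation obstruction (d) vanishes) → HorizontalPatching (canonicity upstairs:
BM/ATW functorial centres of local lifts agree where lifts agree to high p-adic order, Artin
approximation) → EquisingularLift; and, if coalescence is shown forced, EquisingularLift ⇐
EquisingularLiftUncollided (allow vertical blow-ups only at the regular collision loci of char-0
centres) → CollisionResolution → EquisingularLift (k ≤ 3, depth 1). Calibration support to file when
seated: CurveCase (n = 2, Ishii2025 Cor 1.5 in this typing) and RDPCase (Artin1977 forms).

KILL CRITERIA. CLOSE refuted:EquisingularLift if a refuter proves, for one explicit hypersurface H
over F_p-bar (a surface suffices), that NO characteristic-0 DVR and NO horizontal regular-centre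
sequence resolves it — e.g. by an invariant of H that every horizontal simultaneous resolution would
force to agree with a characteristic-0 value it cannot take; PIVOT (restate, class misstated) to
EquisingularLiftUncollided (vertical blow-ups permitted only at collision loci of char-0 centres,
i.e. special fibre of P' = strict transform of P_s plus exceptional divisors over 0-dimensional
collision schemes) if the refutation only exhibits forced collisions; CLOSE superseded if route
MarkedTransfer's HypersurfaceOrderReduction or WeightedInvariant's WeightedConstruction closes
PROVED (embedded hypersurface resolution in char p then needs no lift). HypersurfacesSuffice refuted
⇒ re-type only (classical theorem; its reduced ⇒ integral-projective half is already a tree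
theorem).

NOT DECOMPOSED YET. The engine that PRODUCES the lift (card p-adic-equisingular-lifting D2: the
envelope invariant inv^lift = max over lifts of the char-0 invariant, its semicontinuity and drop;
card ramified-coalescence-weights: Teichmueller lift + ramified base change) is filed after open as
an informal rank-3 crux MostSingularLift (no Lean signature: Hironaka's invariant is not in the
tree); the local-to-global step and the collision analysis are layer-2 (Two-layer plan); the
mixed-characteristic bookkeeping (strict transform of {π = 0} under a horizontal blow-up = blow-up
of the special fibre in the scheme-theoretic special fibre of the centre, Stacks 080C) is
prover-level support.

CHEAPEST FALSIFIER. Dimension 1 is a THEOREM in this exact shape (Ishii2025 Cor 1.5 / Campillo1980: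
successive point blow-ups at lifted points = horizontal sections), so the first honest test is a
SURFACE: take Artin's non-taut E_8^r (char 2, 3, 5) and a Zariski surface z^p = f(x,y) at a kangaroo
step (Hauser's x^2 + y^7 + yz^4, char 2; HauserPerlega2019 §3), lift over Z_p^{ur}[p^{1/e}] for
small e, run Bierstone–Milman (Singular resolve.lib over Q(p^{1/e})) on the generic fibre and reduce
the centres: do the closures stay regular and does the special fibre follow? A 'no lift with e ≤ 4
works' outcome for the E_8^r forms (where resolution is known and the Dynkin type lifts, Artin1977)
would refute EL_p in dimension 2 at once. Not run this session (needs Singular over a ramified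
p-adic order; a kit job spec is the first task of the MostSingularLift seat).

NUMBERS. Known cases of EL_p in this typing: n = 2 (curves) all p (Ishii2025 Thm 1.1 (iv), Cor 1.5);
Teissier singularities, all dimensions (MourtadaSchober2025 Thm 1.3, over O_{C_p}); RDPs E_8^r,
D_n^r, E_6^r, E_7^r in char 2, 3, 5 lift with their Dynkin type (Artin1977). Valuative skeleton
lifting fails for N ≥ 3, i ≥ 3 blow-ups (Kollar2026). Summit needs dim H ≥ 4 (CossartPiltant2019
covers ≤ 3).

DEFINITION REQUESTS. None needed for the typed items (tree: IsBlowup, Scheme.IsRegular,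
Scheme.HasResolution, IdealSheafData.vanishingIdeal/subscheme, Smooth, IsDiscreteValuationRing;
IsEmbeddedTransform is inlined as its induction principle because its home
Literature/AlgebraicGeometry/Resolution/EmbeddedResolution.lean imports EffectiveResolution and
ResolutionOfCurves, whose cones carry BierstoneGrigorievMilmanWlodarczyk2011,
AbramovichOortConjecture, Temkin2013 and the Cossart–Piltant/CJS named facts — a cone-clean home for
the inductive and for hasResolution_of_isEmbeddedTransform (imports Blowups + BlowupsProper + the
Statement file suffice) would let a later revision name it again; recorded here, not requested).
SUPPORT ITEMS: none since rev 2 — the rev-1 supports ProjectiveIntegralSuffices (absorbed into the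
crux HypersurfacesSuffice) and EmbeddedTransformResolves (proved inside the deciding theorem
`closes`, over the cone-clean imports BlowupsProperProofs + ComponentGluing) were dropped so that
`closes` assumes cruxes only (human ruling 2026-08-16). Wanted later for the informal crux
MostSingularLift: `EnvelopeInvariant` (max over lifts of a char-0 resolution invariant) under
Summits/ResolutionOfSingularities/ResolutionOfSingularities/Theorems — to be requested by the tenure
planner once a char-0 invariant (Kollar2007MarkedOrderReduction data in tree) is chosen.

Novelty: Searches (2026-08-16): lit search --source s2 "equisingular lifting curve singularities
characteristic p characteristic zero" (15 hits: Ishii2025 arXiv:2506.23533, Campillo–Greuel–Lossen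
math/0511407, Langer 1711.05252, Greuel 1711.03453); lit read arXiv:2502.01239 pp.1-4
(MourtadaSchober2025 Thm 1.3, Def 1.2) and arXiv:2506.23533 pp.1-5,14,18 (Ishii2025 Thm 1.1, Cor
1.5, Rem 4.3 → Kollar2026 arXiv:2603.04211); lit galaxy search "equisingular" --star all (31 rows,
none on lifting to char 0), "lifting to characteristic zero" --star pdf (1 irrelevant); OpenAlex/S2
further queries rate-limited (HTTP 429), recorded; ledger: 12 route files read (Theses/*.lean incl.
MarkedTransfer, WildQuotient opened today), 109 summit cards listed, cards
p-adic-equisingular-lifting / ramified-coalescence-weights / neron-delta-arc-smoothening read with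
their triage notes; lean search --decl for every constant (IsEmbeddedTransform, IsBlowup,
vanishingIdeal, projectiveSpace, stub_projectiveIntegralSuffices, stacks02NS_holds,
hasResolution_of_isEmbeddedTransform).
Nearest prior art found: MourtadaSchober2025 (arXiv:2502.01239) Thm 1.3 — equisingular lift with
quasi-ordinary char-0 generic fibre for TEISSIER singularities, and the printed suggestion of a
Jung-type programme through them; Ishii2025 (arXiv:2506.23533) Thm 1.1/Cor 1.5 — skeleton lifting of
point blow-ups, EL for plane curves, with Kollar2026 as the obstruction to the valuative version in
dimension ≥ 3; on the ledger, cards p-adic-equisin  [refs: 2506.23533, 2502.01239, 2603.04211, Ishii2025, MourtadaSchober2025, Kollar2026]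

Barriers (technique_class: witt-lift, equisingular-specialisation): - technique_class: witt-lift, equisingular-specialisation
- Literature.Barriers.ResolutionOfSingularities.Narasimhan1983_noSmoothHypersurfaceThroughTopLocus:
evaded — no hypersurface of maximal contact is chosen in characteristic p; centres are special
fibres of characteristic-0 centres (where maximal contact exists) and may be singular/non-reduced as
char-p subschemes.
- Literature.Barriers.ResolutionOfSingularities.Hauser2003_kangarooShadeIncrease: not evaded as a
phenomenon, re-located: the kangaroo jump is the reduction mod p of a p-adically small coefficient
of the lift's coefficient ideal (card p-adic-equisingular-lifting); the bet is that a lift over a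
sufficiently ramified O' carries char-0 centres through the jump — this is the content of
EquisingularLift, not assumed away.
- Literature.Barriers.ResolutionOfSingularities.hauserPerlega_mohProofBoundFails: same — no residual
order is tracked in char p; termination is Hironaka's upstairs; the risk is transferred to 'the
special fibre follows', i.e. to EquisingularLift.
- Literature.Barriers.ResolutionOfSingularities.DimensionFourFrontier: evaded as architecture (no
local uniformization, no Zariski patching, no induction on dimension in char p); not evaded as
knowledge: EL is proved in print only for curves and Teissier singularities.
- Literature.Barriers.ResolutionOfSingularities.InseparableBaseChange: respected by scope — EL and
HM are stated over ALGEBRAICALLY CLOSED fields (lifts need rational singular points and W(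

History (route lifecycle, newest last):
- 2026-08-16T16:35:35Z · rev 1: restated EquisingularLift (stmt-ResolutionOfSingularities-16071), Assembly (stmt-ResolutionOfSingularities-16073) — cone repair (rrepair, D-0023 guardrail): the rev-0 import cone carried 16 unproved Literature facts (BGMW2011 via EmbeddedResolution→EffectiveResolution; Abramo (planner-rrepair-ResolutionOfSingularities-Equi-e059a36a-0)
- 2026-08-16T16:58:07Z · rev 2: restated HypersurfaceModels (stmt-ResolutionOfSingularities-16072), Assembly (stmt-ResolutionOfSingularities-15661) — rev 2 (rrepair g2; gate stamp glue.non-crux-hypothesis): CRUX-ONLY deciding theorem. closes : EquisingularLift → HypersurfacesSuffice → DescentAlgclosedToPerfec (planner-rrepair-ResolutionOfSingularities-Equi-e059a36a-g2-0)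
- 2026-08-16T16:58:07Z · rev 2: dropped ProjectiveIntegralSuffices, EmbeddedTransformResolves — rev 2 (rrepair g2; gate stamp glue.non-crux-hypothesis): CRUX-ONLY deciding theorem. closes : EquisingularLift → HypersurfacesSuffice → DescentAlgclosedToPerfec (planner-rrepair-ResolutionOfSingularities-Equi-e059a36a-g2-0)
- 2026-08-25T13:58:36Z · DORMANT — reconciler: no traction for 7.8 d (last activity item-evidence-added at 2026-08-17T19:15:56Z); parked, not closed — `ledger route dormant route-ResolutionOfSing (operator:999:3319442)
- 2026-08-26T16:26:12Z · REACTIVATED — dormant cleared (operator:999:1116883)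

sub-problem: ResolutionOfSingularities · status: open · opened planner-plan-novel-ResolutionOfSingularities-Re-dc19aa3a-b-v2-0 2026-08-16T16:16:54Z · rev 4 · ledger route-ResolutionOfSingularities-EquisingularLift
GENERATED by the gate from the ledger (D-0016/17). Provers cite these decls: `theorem foo : Summit.ResolutionOfSingularities.ResolutionOfSingularities.Theses.EquisingularLift.<Decl> := …` in Summits/ResolutionOfSingularities/ResolutionOfSingularities/Theorems/<Name>.lean.
-/

namespace Summit.ResolutionOfSingularities.ResolutionOfSingularities.Theses.EquisingularLift

open scoped BigOperators Topology Manifold Classical MeasureTheory ProbabilityTheory Matrix InnerProductSpace ComplexConjugate ContinuousMap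
open Filter Set Function TopologicalSpace MeasureTheory

attribute [summit_statement] _root_.ResolutionOfSingularities

-- earlier EquisingularLift (stmt-ResolutionOfSingularities-16071, replaced 2026-08-16T16:35:35Z -> stmt-ResolutionOfSingularities-15660): retired by None — ∀ p : ℕ, p.Prime → ∀ (k : Type) [Field k] [CharP k p] [IsAlgClosed k] (n : ℕ) (H : AlgebraicGeometry.Scheme.{0}) (ι : H ⟶ (Literature.AlgebraicGeometry.Motives.projectiveSpace n k).left), AlgebraicGeometry.IsClosedImmersion ι → AlgebraicGeometry.
/-- item stmt-ResolutionOfSingularities-15660 · crux · rank 2 · open · by planner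
why it might fail: a char-p singular locus can exceed every lift's (Kollar2026 via Ishii2025 Rem 4.3; kangaroo points HauserPerlega2019): distinct char-0 centres may be forced to collide in the special fibre, whose closure is then not regular — vertical un-colliding blow-ups are excluded by the typing.
sources: Ishii2025, MourtadaSchober2025, Kollar2026, Campillo1980, Artin1977, HauserPerlega2019
[crux] (rev 1 = rev 0 with the blow-up sequence re-encoded; same mathematics) for every prime p,
every algebraically closed k of char p, every n and every integral closed H ⊆ P^n_k with locally
principal ideal: there are a DVR O of characteristic 0, a smooth proper q : P → Spec O, a closed
subset Y of P inside the special fibre whose reduced induced subscheme is isomorphic to H, and σ :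
P' → P with S' ⊆ P' such that (P', σ, S') is reached from (P, id, Y) by finitely many blow-ups in
REGULAR centres lying over {x | x is not a generic point of Y}, S' being the iterated strict
transform (stated as the induction principle of the tree inductive IsEmbeddedTransform, to which it
is equivalent — planner probe chain_iff rc 0 — so that the route file imports only
Resolution.Blowups), the special fibre of P' → Spec O is IRREDUCIBLE (all centres horizontal) and
the reduced closed subscheme on the closure of S' is regular (cards p-adic-equisingular-lifting D1,
ramified-coalescence-weights Crux 1). [difficulty: open-problem] -/
@[route_item "route-ResolutionOfSingularities-EquisingularLift", crux (bottleneck := idea) (experiment := "instrument: ℤ/p cells …), mostly dimension ≤ 3 or cell-by-cell in dim 4; NONE is certified by a tribunal as a split of a ▶ blocker into all-WEAKER piec…") (source := "director HOURLY-RESOLUTION l.1136 + director RESOLUTION l.91, 2026-09-01")]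
def EquisingularLift : Prop :=
  ∀ p : ℕ, p.Prime → ∀ (k : Type) [Field k] [CharP k p] [IsAlgClosed k] (n : ℕ) (H : AlgebraicGeometry.Scheme.{0}) (ι : H ⟶ (Literature.AlgebraicGeometry.Motives.projectiveSpace n k).left), AlgebraicGeometry.IsClosedImmersion ι → AlgebraicGeometry.IsIntegral H → (∀ y : (Literature.AlgebraicGeometry.Motives.projectiveSpace n k).left, ∃ U : (Literature.AlgebraicGeometry.Motives.projectiveSpace n k).left.affineOpens, y ∈ (U : (Literature.AlgebraicGeometry.Motives.projectiveSpace n k).left.Opens) ∧ (ι.ker.ideal U).IsPrincipal) → ∃ (O : Type) (_ : CommRing O) (_ : IsDomain O) (_ : IsDiscreteValuationRing O) (_ : CharZero O) (P P' : AlgebraicGeometry.Scheme.{0}) (q : P ⟶ AlgebraicGeometry.Spec (.of O)) (Y : TopologicalSpace.Closeds P) (σ : P' ⟶ P) (S' : Set P'), AlgebraicGeometry.Smooth q ∧ AlgebraicGeometry.IsProper q ∧ (Y : Set P) ⊆ q ⁻¹' {IsLocalRing.closedPoint O} ∧ Nonempty ((AlgebraicGeometry.Scheme.IdealSheafData.vanishingIdeal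 Y).subscheme ≅ H) ∧ (∀ Q : (∀ X' : AlgebraicGeometry.Scheme.{0}, (X' ⟶ P) → Set X' → Prop), Q P (CategoryTheory.CategoryStruct.id P) (Y : Set P) → (∀ (X' X'' : AlgebraicGeometry.Scheme.{0}) (σ' : X' ⟶ P) (Y' : Set X') (C : X'.IdealSheafData) (τ : X'' ⟶ X'), Q X' σ' Y' → Literature.AlgebraicGeometry.Resolution.IsBlowup τ C → Literature.AlgebraicGeometry.Resolution.Scheme.IsRegular C.subscheme → σ' '' (C.support : Set X') ⊆ {x : P | ¬ IsGenericPoint x (Y : Set P)} → Q X'' (CategoryTheory.CategoryStruct.comp τ σ') (closure (τ ⁻¹' (Y' \ (C.support : Set X'))))) → Q P' σ S') ∧ IsIrreducible ((CategoryTheory.CategoryStruct.comp σ q) ⁻¹' {IsLocalRing.closedPoint O}) ∧ Literature.AlgebraicGeometry.Resolution.Scheme.IsRegular (AlgebraicGeometry.Scheme.IdealSheafData.vanishingIdeal (⟨closure S', isClosed_closure⟩ : TopologicalSpace.Closeds P')).subscheme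

/-- item stmt-ResolutionOfSingularities-20038 · crux · rank 3 · open · by planner
why it might fail: P := P^n_O fixed + E1 forbid the un-colliding/linear centres that made EL summit-equivalent: distinct char-0 centres may be FORCED to collide in the special fibre (kangaroo points), closure not regular; log-liftability to W_2 fails for X(7A_1), char 2; the CJS canonical tower of H_F does not lift.
sources: Ishii2025, MourtadaSchober2025, Kollar2026, HauserPerlega2019, arXiv:2008.07700, arXiv:2302.13235
[crux] EL♮ = EquisingularLiftNat (RESCUE-SEED v0.6.1 §6b (A′); director-resolution RULINGS
2026-08-27T00:46:45Z option (a) + 00:51:42Z (A′) adopted). EquisingularLift with the ambient FIXED: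
P := ℙⁿ_O (= (Literature.AlgebraicGeometry.Crystalline.projectiveSpaceOver n O).left, spelled
import-free as Proj (MvPolynomial.homogeneousSubmodule (Fin (n+1)) O) — rfl), q := its structure
morphism, Y := the image of H under ι ≫ (ℙⁿ_k ↪ ℙⁿ_O) (Proj.map φ, φ = MvPolynomial.map π graded), O
existential: a characteristic-0 DVR with a surjection π : O → k (residue field k); AND on every step
of the blow-up chain E1 «the special-fibre points of the REGULAR centre lie in the CURRENT strict
transform»: C.support ∩ (σ' ≫ q)⁻¹{closedPoint O} ⊆ Y'. Conclusion as EL: the chain (induction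
principle), IRREDUCIBLE special fibre of the last ambient (all centres horizontal), REGULAR reduced
closure of the strict transform. ≥ S over k̄ for n ≥ 5 (LINEAR-CENTRE equivalence +
HypersurfacesSuffice); plausibly strictly stronger (kangaroo-forced special-fibre collisions, route
l.274); the bet is MECHANISM — a terminating clock BORROWED from characteristic 0
(Kollar2007Principalization_holds / Hironaka1964_holds in -/
@[route_item "route-ResolutionOfSingularities-EquisingularLift", crux]
def EquisingularLiftNat : Prop :=
  ∀ p : ℕ, p.Prime → ∀ (k : Type) [Field k] [CharP k p] [IsAlgClosed k] (n : ℕ) (H : AlgebraicGeometry.Scheme.{0}) (ι : H ⟶ (Literature.AlgebraicGeometry.Motives.projectiveSpace n k).left), AlgebraicGeometry.IsClosedImmersion ι → AlgebraicGeometry.IsIntegral H → (∀ y : (Literature.AlgebraicGeometry.Motives.projectiveSpace n k).left, ∃ U : (Literature.AlgebraicGeometry.Motives.projectiveSpace n k).left.affineOpens, y ∈ (U : (Literature.AlgebraicGeometry.Motives.projectiveSpace n k).left.Opens) ∧ (ι.ker.ideal U).IsPrincipal) → ∃ (O : Type) (_ : CommRing O) (_ : IsDomain O) (_ : IsDiscreteValuationRing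 O) (_ : CharZero O) (π : O →+* k), Function.Surjective π ∧ (letI := MvPolynomial.gradedAlgebra (σ := Fin (n + 1)) (R := O); letI := MvPolynomial.gradedAlgebra (σ := Fin (n + 1)) (R := k); ∀ (φ : MvPolynomial.homogeneousSubmodule (Fin (n + 1)) O →+*ᵍ MvPolynomial.homogeneousSubmodule (Fin (n + 1)) k) (hφ' : HomogeneousIdeal.irrelevant (MvPolynomial.homogeneousSubmodule (Fin (n + 1)) k) ≤ (HomogeneousIdeal.irrelevant (MvPolynomial.homogeneousSubmodule (Fin (n + 1)) O)).map φ), (∀ s, φ s = MvPolynomial.map π s) → ∀ Y : Set (AlgebraicGeometry.Proj (MvPolynomial.homogeneousSubmodule (Fin (n + 1)) O)), Y = Set.range (CategoryTheory.CategoryStruct.comp ι (AlgebraicGeometry.Proj.map φ hφ') : H ⟶ (AlgebraicGeometry.Proj (MvPolynomial.homogeneousSubmodule (Fin (n + 1)) O))) → ∃ (P' : AlgebraicGeometry.Scheme.{0}) (σ : P' ⟶ (AlgebraicGeometry.Proj (MvPolynomial.homogeneousSubmodule (Fin (n + 1)) O))) (S' : Set P'), (∀ Q : (∀ X' : AlgebraicGeometry.Scheme.{0},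 (X' ⟶ (AlgebraicGeometry.Proj (MvPolynomial.homogeneousSubmodule (Fin (n + 1)) O))) → Set X' → Prop), Q (AlgebraicGeometry.Proj (MvPolynomial.homogeneousSubmodule (Fin (n + 1)) O)) (CategoryTheory.CategoryStruct.id _) Y → (∀ (X' X'' : AlgebraicGeometry.Scheme.{0}) (σ' : X' ⟶ (AlgebraicGeometry.Proj (MvPolynomial.homogeneousSubmodule (Fin (n + 1)) O))) (Y' : Set X') (C : X'.IdealSheafData) (τ : X'' ⟶ X'), Q X' σ' Y' → Literature.AlgebraicGeometry.Resolution.IsBlowup τ C → Literature.AlgebraicGeometry.Resolution.Scheme.IsRegular C.subscheme → σ' '' (C.support : Set X') ⊆ {x | ¬ IsGenericPoint x Y} → (C.support : Set X') ∩ (CategoryTheory.CategoryStruct.comp σ' (CategoryTheory.CategoryStruct.comp (AlgebraicGeometry.Proj.toSpecZero (MvPolynomial.homogeneousSubmodule (Fin (n + 1)) O)) (AlgebraicGeometry.Spec.map (CommRingCat.ofHom (algebraMap O (MvPolynomial.homogeneousSubmodule (Fin (n + 1)) O 0)))))) ⁻¹' {IsLocalRing.closedPoint O} ⊆ Y' →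 Q X'' (CategoryTheory.CategoryStruct.comp τ σ') (closure (τ ⁻¹' (Y' \ (C.support : Set X'))))) → Q P' σ S') ∧ IsIrreducible ((CategoryTheory.CategoryStruct.comp σ (CategoryTheory.CategoryStruct.comp (AlgebraicGeometry.Proj.toSpecZero (MvPolynomial.homogeneousSubmodule (Fin (n + 1)) O)) (AlgebraicGeometry.Spec.map (CommRingCat.ofHom (algebraMap O (MvPolynomial.homogeneousSubmodule (Fin (n + 1)) O 0)))))) ⁻¹' {IsLocalRing.closedPoint O}) ∧ Literature.AlgebraicGeometry.Resolution.Scheme.IsRegular (AlgebraicGeometry.Scheme.IdealSheafData.vanishingIdeal (⟨closure S', isClosed_closure⟩ : TopologicalSpace.Closeds P')).subscheme)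

/-- item stmt-ResolutionOfSingularities-20148 · crux · rank 3 · open · by planner
why it might fail: n = 3 non-isolated half needs an embedded DVR-lift of the double curve of H (non-liftable smooth space curves over F_p-bar: printed-open, Hartshorne DT Rem 22.3.1); isolated half needs termination of the shadowed CJS sequence under Delta-steps with damage and at tie points (specimen S-F).
sources: ULT-STATUS v2 dc9b013f8ab10ea1, CHAIN w45b v7.2 cc680ebab4e4e8d9, LEAD-MEMO-2 v1.5 33c5a688bd5e3154, PLANNER-MEMO-g7-1 v2 43d137205e2d398d, corpus:book:springernd-deformation-theory p.151 Rem 22.3.1, arXiv:0905.2191 (Cossart-Jannsen-Saito)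
[crux] n = 3 case of EL♮ (EquisingularLiftNat restricted to n = 3; text = registered skeleton v4
stub_elnat_three verbatim under ∀ p); why it might fail: surface-singular-locus lifting at n = 3
beyond the printed frontier (LIFT₃-class non-isolated double curves; termination under Δ-with-damage
on the isolated side); sources: ULT-STATUS v2 dc9b013f8ab10ea1, CHAIN w45b v7.1 fcf8bbc4526b5d82,
LEAD-MEMO-2 v1.4, PLANNER-MEMO v2; director-resolution RULING 06:57:05Z «SPLIT BY n = GO NOW» (2);
parent ∀ n item stmt-ResolutionOfSingularities-20038 stays refuter-facing and load-bearing for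
closes -/
@[route_item "route-ResolutionOfSingularities-EquisingularLift"]
def EquisingularLiftNatThree : Prop :=
  ∀ p : ℕ, p.Prime → ∀ (k : Type) [Field k] [CharP k p] [IsAlgClosed k] (n : ℕ) (H : AlgebraicGeometry.Scheme.{0}) (ι : H ⟶ (Literature.AlgebraicGeometry.Motives.projectiveSpace n k).left), AlgebraicGeometry.IsClosedImmersion ι → AlgebraicGeometry.IsIntegral H → (∀ y : (Literature.AlgebraicGeometry.Motives.projectiveSpace n k).left, ∃ U : (Literature.AlgebraicGeometry.Motives.projectiveSpace n k).left.affineOpens, y ∈ (U : (Literature.AlgebraicGeometry.Motives.projectiveSpace n k).left.Opens) ∧ (ι.ker.ideal U).IsPrincipal) → n = 3 → ∃ (O : Type) (_ : CommRing O) (_ : IsDomain O) (_ : IsDiscreteValuationRing O) (_ : CharZero O) (π : O →+* k), Function.Surjective π ∧ (letI := MvPolynomial.gradedAlgebra (σ := Fin (n + 1)) (R := O); letI := MvPolynomial.gradedAlgebra (σ := Fin (n + 1)) (R := k); ∀ (φ : MvPolynomial.homogeneousSubmodule (Fin (n + 1)) O →+*ᵍ MvPolynomial.homogeneousSubmodule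 (Fin (n + 1)) k) (hφ' : HomogeneousIdeal.irrelevant (MvPolynomial.homogeneousSubmodule (Fin (n + 1)) k) ≤ (HomogeneousIdeal.irrelevant (MvPolynomial.homogeneousSubmodule (Fin (n + 1)) O)).map φ), (∀ s, φ s = MvPolynomial.map π s) → ∀ Y : Set (AlgebraicGeometry.Proj (MvPolynomial.homogeneousSubmodule (Fin (n + 1)) O)), Y = Set.range (CategoryTheory.CategoryStruct.comp ι (AlgebraicGeometry.Proj.map φ hφ') : H ⟶ (AlgebraicGeometry.Proj (MvPolynomial.homogeneousSubmodule (Fin (n + 1)) O))) → ∃ (P' : AlgebraicGeometry.Scheme.{0}) (σ : P' ⟶ (AlgebraicGeometry.Proj (MvPolynomial.homogeneousSubmodule (Fin (n + 1)) O))) (S' : Set P'), (∀ Q : (∀ X' : AlgebraicGeometry.Scheme.{0}, (X' ⟶ (AlgebraicGeometry.Proj (MvPolynomial.homogeneousSubmodule (Fin (n + 1)) O))) → Set X' → Prop), Q (AlgebraicGeometry.Proj (MvPolynomial.homogeneousSubmodule (Fin (n + 1)) O)) (CategoryTheory.CategoryStruct.id _) Y → (∀ (X' X'' : AlgebraicGeometry.Scheme.{0})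 (σ' : X' ⟶ (AlgebraicGeometry.Proj (MvPolynomial.homogeneousSubmodule (Fin (n + 1)) O))) (Y' : Set X') (C : X'.IdealSheafData) (τ : X'' ⟶ X'), Q X' σ' Y' → Literature.AlgebraicGeometry.Resolution.IsBlowup τ C → Literature.AlgebraicGeometry.Resolution.Scheme.IsRegular C.subscheme → σ' '' (C.support : Set X') ⊆ {x | ¬ IsGenericPoint x Y} → (C.support : Set X') ∩ (CategoryTheory.CategoryStruct.comp σ' (CategoryTheory.CategoryStruct.comp (AlgebraicGeometry.Proj.toSpecZero (MvPolynomial.homogeneousSubmodule (Fin (n + 1)) O)) (AlgebraicGeometry.Spec.map (CommRingCat.ofHom (algebraMap O (MvPolynomial.homogeneousSubmodule (Fin (n + 1)) O 0)))))) ⁻¹' {IsLocalRing.closedPoint O} ⊆ Y' → Q X'' (CategoryTheory.CategoryStruct.comp τ σ') (closure (τ ⁻¹' (Y' \ (C.support : Set X'))))) → Q P' σ S') ∧ IsIrreducible ((CategoryTheory.CategoryStruct.comp σ (CategoryTheory.CategoryStruct.comp (AlgebraicGeometry.Proj.toSpecZero (MvPolynomial.homogeneousSubmodule (Fin (n + 1))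 O)) (AlgebraicGeometry.Spec.map (CommRingCat.ofHom (algebraMap O (MvPolynomial.homogeneousSubmodule (Fin (n + 1)) O 0)))))) ⁻¹' {IsLocalRing.closedPoint O}) ∧ Literature.AlgebraicGeometry.Resolution.Scheme.IsRegular (AlgebraicGeometry.Scheme.IdealSheafData.vanishingIdeal (⟨closure S', isClosed_closure⟩ : TopologicalSpace.Closeds P')).subscheme)

/-- item stmt-ResolutionOfSingularities-15964 · crux · rank 4 · closed · proved by Summit.ResolutionOfSingularities.ResolutionOfSingularities.Theorems.HypersurfacesSuffice.HypersurfacesSuffice_of @ 0a0ff848ab3d (prover) · by planner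
why it might fail: only if mis-typed: classical (Hartshorne I.4.9 generic projection + normalisation transfer + CossartPiltant2019 Prop 4.6); birationality of a generic LINEAR projection needs k(X)/k separably generated — true for k perfect — and the image taken closed in P^{d+1} with locally principal ideal.
sources: Hartshorne1977 (Prop I.4.9), Kollar2007, CossartPiltant2019 (Prop 4.6, proof Steps 1-3), StacksProject, Summits/ResolutionOfSingularities/ResolutionOfSingularities/Theorems/WeightedInvariantWeightedThesisProjectiveIntegralSuffices.lean (stub_projectiveIntegralSuffices)
[crux] HYPERSURFACES SUFFICE (k algebraically closed, any characteristic): if every integral closed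
H ⊆ P^m_k whose ideal is locally principal (a hypersurface) has a resolution of singularities, then
every reduced separated k-scheme of finite type has one. = (reduced ⇒ integral closed subschemes of
P^n: irreducible components with reduced structure, Chow's lemma, projective closure, transport
along open immersions / proper birational maps — IN TREE verbatim as
Theorems.WeightedThesis.ProjectiveIntegralSuffices.stub_projectiveIntegralSuffices,
CossartPiltant2019 Prop 4.6 Steps 1–3) + (integral closed X ⊆ P^n ⇒ hypersurface model: generic
linear projection X → P^{dim X+1}, finite and birational onto its closed image H since k(X)/k is
separably generated (k perfect), Hartshorne1977 I.4.9; a resolution of H is regular hence normal, so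
it factors through X, which is integral over H inside k(H) = k(X), and resolves X — tree:
WeightedThesis.FiniteBirationalTransfer landed, HypersurfaceModel{Image,Projection,FieldCore}
landing). Supersedes rev-1 HypersurfaceModels (stmt-ResolutionOfSingularities-16072) by composing it
with the dropped support ProjectiveIntegralSuffices (stmt-ResolutionOfSi -/
@[route_item "route-ResolutionOfSingularities-EquisingularLift", crux]
def HypersurfacesSuffice : Prop :=
  ∀ (k : Type) [Field k] [IsAlgClosed k], (∀ (m : ℕ) (H : AlgebraicGeometry.Scheme.{0}) (ι' : H ⟶ (Literature.AlgebraicGeometry.Motives.projectiveSpace m k).left), AlgebraicGeometry.IsClosedImmersion ι' → AlgebraicGeometry.IsIntegral H → (∀ y : (Literature.AlgebraicGeometry.Motives.projectiveSpace m k).left, ∃ U : (Literature.AlgebraicGeometry.Motives.projectiveSpace m k).left.affineOpens, y ∈ (U : (Literature.AlgebraicGeometry.Motives.projectiveSpace m k).left.Opens) ∧ (ι'.ker.ideal U).IsPrincipal) → Literature.AlgebraicGeometry.Resolution.Scheme.HasResolution H) → ∀ (X : AlgebraicGeometry.Scheme.{0}) (f : X ⟶ AlgebraicGeometry.Spec (.of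 k)), AlgebraicGeometry.IsSeparated f → AlgebraicGeometry.LocallyOfFiniteType f → AlgebraicGeometry.QuasiCompact f → AlgebraicGeometry.IsReduced X → Literature.AlgebraicGeometry.Resolution.Scheme.HasResolution X

-- `HypersurfacesSuffice` holds: proved by `Summit.ResolutionOfSingularities.ResolutionOfSingularities.Theorems.HypersurfacesSuffice.HypersurfacesSuffice_of` @ 0a0ff848ab3d (its module imports this route file, so no `_holds` link can be stated here).

/-- item stmt-ResolutionOfSingularities-0550 · crux · rank 5 · open · by planner
why it might fail: print gets kbar ⇒ perfect k only for Galois-EQUIVARIANT resolutions (BGMW2011 Remark; Kollar2007 Thm 3.36); from bare existence the Galois-symmetrised fibre product is singular; false if some X over F_q has no Gal-stable resolution.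
sources: Kollar2007, arXiv:1206.3090, Literature.Barriers.ResolutionOfSingularities.InseparableBaseChange
AlgClosedToPerfect: for a prime p, resolution of all reduced separated finite-type schemes over all
ALGEBRAICALLY CLOSED fields of char p implies the same over all PERFECT fields of char p. Needs
Galois descent of some resolution (a Gal-invariant one), i.e. a canonicity input, or a trick
avoiding it. -/
@[route_item "route-ResolutionOfSingularities-EquisingularLift", crux]
def DescentAlgclosedToPerfect : Prop :=
  ∀ p : ℕ, p.Prime → (∀ (k : Type) [Field k] [CharP k p] [IsAlgClosed k] (X : AlgebraicGeometry.Scheme.{0}) (f : X ⟶ AlgebraicGeometry.Spec (.of k)), AlgebraicGeometry.IsSeparated f → AlgebraicGeometry.LocallyOfFiniteType f → AlgebraicGeometry.QuasiCompact f → AlgebraicGeometry.IsReduced X → Literature.AlgebraicGeometry.Resolution.Scheme.HasResolution X) → ∀ (k : Type) [Field k] [CharP k p] [PerfectField k] (X : AlgebraicGeometry.Scheme.{0}) (f : X ⟶ AlgebraicGeometry.Spec (.of k)), AlgebraicGeometry.IsSeparated f → AlgebraicGeometry.LocallyOfFiniteType f → AlgebraicGeometry.QuasiCompact f → AlgebraicGeometry.IsReduced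 X → Literature.AlgebraicGeometry.Resolution.Scheme.HasResolution X

/-- item stmt-ResolutionOfSingularities-0549 · crux · rank 6 · open · by planner
why it might fail: regular is not geometrically regular under inseparable ground-field extension (EGA IV 6.7.4); spreading out needs k/K0 separable, impossible beyond the p-rank (MacLane; k = F_p((t))).
sources: arXiv:math/0703678, CossartPiltant2019, Literature.Barriers.ResolutionOfSingularities.InseparableBaseChange
PerfectToAll: for a prime p, resolution of all reduced separated finite-type schemes over all
PERFECT fields of char p implies ResolutionInChar p (all fields of char p). Expected inputs:
Neron-Popescu (Stacks 07GC), spreading out, openness of regular locus on excellent schemes;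
regularity is not stable under inseparable ground field extension, which is the difficulty. -/
@[route_item "route-ResolutionOfSingularities-EquisingularLift", crux]
def DescentPerfectToAll : Prop :=
  ∀ p : ℕ, p.Prime → (∀ (k : Type) [Field k] [CharP k p] [PerfectField k] (X : AlgebraicGeometry.Scheme.{0}) (f : X ⟶ AlgebraicGeometry.Spec (.of k)), AlgebraicGeometry.IsSeparated f → AlgebraicGeometry.LocallyOfFiniteType f → AlgebraicGeometry.QuasiCompact f → AlgebraicGeometry.IsReduced X → Literature.AlgebraicGeometry.Resolution.Scheme.HasResolution X) → Literature.AlgebraicGeometry.Resolution.ResolutionInChar.{0} p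

-- item stmt-ResolutionOfSingularities-16080 · support · rank 3 · open · by planner — informal only, no Lean statement yet:
--   [crux] MOST SINGULAR LIFT (engine of EquisingularLift; cards p-adic-equisingular-lifting D2 +
--   ramified-coalescence-weights): for a hypersurface germ (X_0,x) over F_p-bar define inv^lift(x) :=
--   max over lifts F~ in O_K[[x]] (K/Q_p^ur finite, ramified allowed) and over points of the generic
--   fibre specialising to x of the characteristic-0 resolution invariant (Hironaka/Bierstone-Milman inv,
--   or the order data of Kollar2007MarkedOrderReduction already in tree); claim: inv^lift is finite,
--   attained, upper semicontinuous on X_0 (Bennett1970 semicontinuity of Hilbert-Samuel functions on the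
--   excellent to

/-- item stmt-ResolutionOfSingularities-19887 · support · rank 9 · closed · proved by Summit.ResolutionOfSingularities.ResolutionOfSingularities.Theorems.EquisingularLiftOfNat_proof (prover) · by planner
[support] The ONE INSTANTIATION EquisingularLiftNat → EquisingularLift (director-resolution RULING
2026-08-27T00:46:45Z): take P := ℙⁿ_O with q its structure morphism (smooth and proper over O:
p159079 stub_projectiveAmbientSmoothProper), Y := ⟨range (ι ≫ Proj.map φ), closed⟩ (inside the
special fibre, V(Y)_red ≅ H: the construction inside p160143 stub_projectiveAmbientFibre with φ :=
⟨MvPolynomial.map π, _⟩, ProjectiveAmbientFibre.isPullback_projMap, p465105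
isIntegral_specialFibre_projectiveSpace), forget E1 (planner sketch equisingularLiftNatA_of_nat,
pure logic), carry the chain / irreducibility / regularity clauses verbatim. Prover task ≈ M
(plumbing over landed helpers). [OURS · L1 W4.5b] [difficulty: M] -/
@[route_item "route-ResolutionOfSingularities-EquisingularLift"]
def EquisingularLiftOfNat : Prop :=
  EquisingularLiftNat → EquisingularLift

-- `EquisingularLiftOfNat` holds: proved by `Summit.ResolutionOfSingularities.ResolutionOfSingularities.Theorems.EquisingularLiftOfNat_proof` (its module imports this route file, so no `_holds` link can be stated here).

-- earlier Assembly (stmt-ResolutionOfSingularities-15661, replaced 2026-08-16T16:58:07Z -> stmt-ResolutionOfSingularities-15965): retired by None — EquisingularLift → HypersurfaceModels → DescentAlgclosedToPerfect → DescentPerfectToAll → ProjectiveIntegralSuffices → EmbeddedTransformResolves → _root_.ResolutionOfSingularities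
-- earlier Assembly (stmt-ResolutionOfSingularities-16073, replaced 2026-08-16T16:35:35Z -> stmt-ResolutionOfSingularities-15661): retired by None — EquisingularLift → HypersurfaceModels → DescentAlgclosedToPerfect → DescentPerfectToAll → _root_.ResolutionOfSingularities
/-- item stmt-ResolutionOfSingularities-15965 · assembly · rank 1 · open · by planner
sources: Kollar2007, CossartPiltant2019
[assembly] rev 2 chain (crux-only): EquisingularLift → HypersurfacesSuffice →
DescentAlgclosedToPerfect → DescentPerfectToAll → ResolutionOfSingularities (the deciding theorem
`closes` as a statement; closable at once by `fun a b c d => closes a b c d`). -/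
@[route_item "route-ResolutionOfSingularities-EquisingularLift"]
def Assembly : Prop :=
  EquisingularLift → HypersurfacesSuffice → DescentAlgclosedToPerfect → DescentPerfectToAll → _root_.ResolutionOfSingularities

-- records of items no longer active in this route (dropped / restated):
-- earlier HypersurfaceModels (stmt-ResolutionOfSingularities-16072, replaced 2026-08-16T16:58:07Z -> stmt-ResolutionOfSingularities-15964): retired by None — ∀ (k : Type) [Field k] [IsAlgClosed k] (n : ℕ) (X : AlgebraicGeometry.Scheme.{0}) (ι : X ⟶ (Literature.AlgebraicGeometry.Motives.projectiveSpace n k).left), AlgebraicGeometry.IsClosedImmersion ι → AlgebraicGeometry.IsIntegral X → ∃ (m : ℕ) (H :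

/-! D-0027 §2.1 — DECIDING THEOREM (planner-authored via `route open/edit --closes-file`; by planner-rrepair-ResolutionOfSingularities-Equi-e059a36a-g2-0 2026-08-16T16:58:07Z):
its hypotheses are this route's items and its conclusion the sub-problem Statement (glue_lint), and it elaborates with this file. -/

@[closes "route-ResolutionOfSingularities-EquisingularLift"] theorem closes (hEL : EquisingularLift) (hHS : HypersurfacesSuffice)
    (hAlg : DescentAlgclosedToPerfect) (hPerf : DescentPerfectToAll) :
    _root_.ResolutionOfSingularities := open AlgebraicGeometry CategoryTheory
      Literature.AlgebraicGeometry.Resolution AlgebraicGeometry.Scheme.IdealSheafData in by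
  classical
  refine _root_.ResolutionOfSingularities_iff.mpr fun p hp => hPerf p hp (hAlg p hp
    fun k _ _ _ X f h1 h2 h3 h4 => hHS k ?_ X f h1 h2 h3 h4)
  intro m H ι' hι' hH hprinc
  obtain ⟨O, _, _, _, _, P, P', q, Y, σ, S', hq, _, _, ⟨e⟩, hET, _, hreg⟩ :=
    hEL p hp k m H ι' hι' hH hprinc
  haveI := hq
  haveI := hH
  haveI : IsLocallyNoetherian P := LocallyOfFiniteType.isLocallyNoetherian q
  let ι₀ : H ⟶ P := CategoryStruct.comp e.inv (vanishingIdeal Y).subschemeι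
  haveI : IsClosedImmersion ι₀ := inferInstance
  have hrange : Set.range ι₀ = (Y : Set P) := by
    rw [← coe_support_vanishingIdeal Y, ← range_subschemeι]
    ext x
    constructor
    · rintro ⟨h, rfl⟩
      exact ⟨e.inv h, (Scheme.Hom.comp_apply _ _ h).symm⟩
    · rintro ⟨y, rfl⟩
      obtain ⟨h, rfl⟩ := e.inv.surjective y
      exact ⟨h, Scheme.Hom.comp_apply _ _ h⟩
  have hgen : IsGenericPoint (ι₀ (genericPoint H)) (Y : Set P) := by
    have h := (genericPoint_spec H).image ι₀.continuous
    rwa [Set.image_univ, ι₀.isClosedEmbedding.isClosed_range.closure_eq, hrange] at h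
  set ξ : P := ι₀ (genericPoint H) with hξdef
  have hYξ : (Y : Set P) = closure {ξ} := hgen.symm
  have hT : ξ ∉ {x : P | ¬ IsGenericPoint x (Y : Set P)} := by
    simp only [Set.mem_setOf_eq, not_not]
    exact hgen
  have L1 : ∀ {A B : Scheme.{0}} (g : A ⟶ B) {W : B.Opens}, IsIso (g ∣_ W) →
      ∀ {y : B}, y ∈ W → ∃! x : A, g x = y := by
    intro A B g W hW y hy
    let eW := Scheme.homeoOfIso (asIso (g ∣_ W))
    have he : ∀ z : ↥((Opens.map g.base).obj W), (eW z).1 = g z.1 := fun z =>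
      morphismRestrict_base_coe g W z
    let y' : ↥(W : Scheme.{0}) := ⟨y, hy⟩
    refine ⟨(eW.symm y').1,
      (he _).symm.trans (congrArg Subtype.val (eW.apply_symm_apply y')), ?_⟩
    intro x (hx : g x = y)
    have hxW : x ∈ (Opens.map g.base).obj W := show g x ∈ W by rw [hx]; exact hy
    have hex : eW ⟨x, hxW⟩ = y' := Subtype.ext ((he _).trans hx)
    exact (congrArg Subtype.val (eW.symm_apply_apply ⟨x, hxW⟩)).symm.trans
      (congrArg (fun w => (eW.symm w).1) hex)
  have L2 : ∀ {A B : Scheme.{0}} (g : A ⟶ B) {W : B.Opens}, IsIso (g ∣_ W) →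
      ∀ {S : Set A}, IsOpen S → S ⊆ ((Opens.map g.base).obj W : Set A) → IsOpen (g '' S) := by
    intro A B g W hW S hS hSW
    let eW := Scheme.homeoOfIso (asIso (g ∣_ W))
    have he : ∀ z : ↥((Opens.map g.base).obj W), (eW z).1 = g z.1 := fun z =>
      morphismRestrict_base_coe g W z
    have himg : g '' S = W.ι '' (eW '' (Scheme.Opens.ι ((Opens.map g.base).obj W) ⁻¹' S)) := by
      ext y
      constructor
      · rintro ⟨x, hx, rfl⟩
        exact ⟨eW ⟨x, hSW hx⟩, ⟨⟨x, hSW hx⟩, hx, rfl⟩, he _⟩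
      · rintro ⟨_, ⟨z, hz, rfl⟩, rfl⟩
        exact ⟨z.1, hz, (he z).symm⟩
    rw [himg]
    exact W.ι.isOpenEmbedding.isOpenMap _
      (eW.isOpenMap _ (hS.preimage (Scheme.Opens.ι ((Opens.map g.base).obj W)).continuous))
  have L3 : ∀ {A B : Scheme.{0}} (g : A ⟶ B) {W : B.Opens}, IsIso (g ∣_ W) →
      ∀ (B' : Set B), g ⁻¹' closure B' ∩ ((Opens.map g.base).obj W : Set A) ⊆ closure (g ⁻¹' B') := by
    intro A B g W hW B'
    rintro x ⟨hxB, hxW⟩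
    rw [mem_closure_iff]
    intro S hS hxS
    have hS' : IsOpen (g '' (S ∩ ((Opens.map g.base).obj W : Set A))) :=
      L2 g hW (hS.inter ((Opens.map g.base).obj W).isOpen) Set.inter_subset_right
    obtain ⟨_, ⟨o, ⟨hoS, -⟩, rfl⟩, hoB⟩ := mem_closure_iff.mp hxB _ hS' ⟨x, ⟨hxS, hxW⟩, rfl⟩
    exact ⟨o, hoS, hoB⟩
  have hstruct : IsProper σ ∧ ∃ V : P.Opens,
      {x : P | ¬ IsGenericPoint x (Y : Set P)}ᶜ ⊆ (V : Set P) ∧ IsIso (σ ∣_ V) ∧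
        ∃ ξ' : P', σ ξ' = ξ ∧ S' = closure {ξ'} := by
    refine hET (fun X' σ' Y' => IsProper σ' ∧ ∃ V : P.Opens,
      {x : P | ¬ IsGenericPoint x (Y : Set P)}ᶜ ⊆ (V : Set P) ∧ IsIso (σ' ∣_ V) ∧
        ∃ ξ' : X', σ' ξ' = ξ ∧ Y' = closure {ξ'}) ?_ ?_
    · -- no blow-up
      refine ⟨inferInstance, ⊤, by simp, ?_, ξ, rfl, hYξ⟩
      infer_instance
    · -- one more blow-up `τ : X'' ⟶ X'` along `C`, regular centre over `T`
      intro X' X'' σ' Y' C τ hQ hτ hC hTC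
      obtain ⟨hσ', V, hTV, hiso, ξ', hξ', hY'⟩ := hQ
      haveI := hσ'
      haveI : IsLocallyNoetherian X' := LocallyOfFiniteType.isLocallyNoetherian σ'
      haveI : IsProper τ := hτ.isProper
      have hclosed : IsClosed (σ' '' (C.support : Set X')) :=
        σ'.isClosedMap _ C.support.isClosed
      let V' : P.Opens := V ⊓ ⟨(σ' '' (C.support : Set X'))ᶜ, hclosed.isOpen_compl⟩
      have hV'V : V' ≤ V := inf_le_left
      have hTV' : {x : P | ¬ IsGenericPoint x (Y : Set P)}ᶜ ⊆ (V' : Set P) :=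
        fun x hx => ⟨hTV hx, fun hx' => hx (hTC hx')⟩
      let Wc : X'.Opens := ⟨(C.support : Set X')ᶜ, C.support.isClosed.isOpen_compl⟩
      have hWc : IsIso (τ ∣_ Wc) := hτ.isIso_morphismRestrict disjoint_compl_left
      have hle : (Opens.map σ'.base).obj V' ≤ Wc := fun x hx hxC => hx.2 ⟨x, hxC, rfl⟩
      have hiso' : IsIso ((CategoryStruct.comp τ σ') ∣_ V') := by
        rw [morphismRestrict_comp]
        have i1 := isIso_morphismRestrict_of_le σ' hiso hV'V
        have i2 := isIso_morphismRestrict_of_le τ hWc hle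
        exact @IsIso.comp_isIso _ _ _ _ _ _ _ i2 i1
      have hξ'C : ξ' ∉ (C.support : Set X') := fun h' => hT (hTC ⟨ξ', h', hξ'⟩)
      obtain ⟨ξ₂, hξ₂, huniq⟩ := L1 τ hWc (y := ξ') hξ'C
      have hfib : τ ⁻¹' {ξ'} = {ξ₂} := by
        ext z
        simp only [Set.mem_preimage, Set.mem_singleton_iff]
        exact ⟨fun hz => huniq z hz, fun hz => hz ▸ hξ₂⟩
      refine ⟨inferInstance, V', hTV', hiso', ξ₂,
        by rw [Scheme.Hom.comp_apply, hξ₂, hξ'], ?_⟩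
      apply le_antisymm
      · refine closure_minimal ?_ isClosed_closure
        rintro x ⟨hxY, hxC⟩
        rw [hY'] at hxY
        have hx := L3 τ hWc {ξ'} ⟨hxY, hxC⟩
        rwa [hfib] at hx
      · refine closure_mono (Set.singleton_subset_iff.mpr ?_)
        refine ⟨?_, ?_⟩
        · rw [hY']
          show τ ξ₂ ∈ closure {ξ'}
          rw [hξ₂]
          exact subset_closure rfl
        · show τ ξ₂ ∉ (C.support : Set X')
          rw [hξ₂]
          exact hξ'C
  obtain ⟨hσ, V, hTV, hiso, ξ', hξ', hY'⟩ := hstruct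
  haveI := hσ
  set Z : Closeds P' := ⟨closure S', isClosed_closure⟩ with hZdef
  have hZ : (Z : Set P') = closure {ξ'} := by
    change closure S' = closure {ξ'}
    rw [hY', closure_closure]
  let j := (vanishingIdeal Z).subschemeι
  haveI : IsIntegral (vanishingIdeal Z).subscheme :=
    ComponentGluing.isIntegral_subscheme_vanishingIdeal Z (hZ ▸ isIrreducible_singleton.closure)
  have hrangej : Set.range j = closure {ξ'} := by
    rw [range_subschemeι, coe_support_vanishingIdeal, hZ]
  have hker : ι₀.ker ≤ (CategoryStruct.comp j σ).ker := by
    have e1 : (CategoryStruct.comp j σ).ker = vanishingIdeal (.closure (σ '' (Z : Set P'))) := by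
      rw [← map_vanishingIdeal]
      rfl
    rw [e1, ← le_support_iff_le_vanishingIdeal]
    have e2 : (ι₀.ker.support : Set P) = Set.range ι₀ := by
      rw [Scheme.Hom.support_ker, ι₀.isClosedEmbedding.isClosed_range.closure_eq]
    rw [← SetLike.coe_subset_coe, e2, Closeds.closure]
    change closure (σ '' (Z : Set P')) ⊆ Set.range ι₀
    rw [hrange, hYξ, hZ]
    refine closure_minimal ((image_closure_subset_closure_image σ.continuous).trans ?_)
      isClosed_closure
    rw [Set.image_singleton, hξ']
  let ρ : (vanishingIdeal Z).subscheme ⟶ H := IsClosedImmersion.lift ι₀ (CategoryStruct.comp j σ) hker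
  have hρ : CategoryStruct.comp ρ ι₀ = CategoryStruct.comp j σ :=
    IsClosedImmersion.lift_fac ι₀ (CategoryStruct.comp j σ) hker
  have hρapp : ∀ y, ι₀ (ρ y) = σ (j y) := fun y => by
    rw [← Scheme.Hom.comp_apply, hρ, Scheme.Hom.comp_apply]
  haveI : IsProper ρ := by
    have hc : IsProper (CategoryStruct.comp ρ ι₀) := by rw [hρ]; infer_instance
    exact MorphismProperty.of_postcomp (W := @AlgebraicGeometry.IsProper)
      (W' := @AlgebraicGeometry.IsSeparated) ρ ι₀ inferInstance hc
  let U : H.Opens := (Opens.map ι₀.base).obj V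
  have hξV : ξ ∈ V := hTV hT
  have hηU : genericPoint H ∈ U := hξV
  obtain ⟨y₀, hy₀⟩ : ξ' ∈ Set.range j := by
    rw [hrangej]
    exact subset_closure rfl
  have hfibξ : σ ⁻¹' {ξ} = {ξ'} := by
    obtain ⟨x, -, huniq⟩ := L1 σ hiso hξV
    ext z
    simp only [Set.mem_preimage, Set.mem_singleton_iff]
    exact ⟨fun hz => (huniq z hz).trans (huniq ξ' hξ').symm, fun hz => hz ▸ hξ'⟩
  have hover : ∀ x : P', σ x ∈ Set.range ι₀ → σ x ∈ V → x ∈ closure {ξ'} := by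
    intro x hx hxV
    rw [hrange, hYξ] at hx
    have hx' := L3 σ hiso {ξ} ⟨hx, hxV⟩
    rwa [hfibξ] at hx'
  have hbir : IsBirational ρ := by
    refine ⟨U, ?_, ?_, ?_⟩
    · have hd : Dense ({genericPoint H} : Set H) := by
        rw [dense_iff_closure_eq]
        exact genericPoint_spec H
      exact hd.mono (Set.singleton_subset_iff.mpr hηU)
    · have hgen' : closure ({y₀} : Set (vanishingIdeal Z).subscheme) = Set.univ := by
        rw [j.isClosedEmbedding.isInducing.closure_eq_preimage_closure_image,
          Set.image_singleton, hy₀, ← hrangej, Set.preimage_range]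
      have hd : Dense ({y₀} : Set (vanishingIdeal Z).subscheme) := by
        rw [dense_iff_closure_eq]
        exact hgen'
      refine hd.mono (Set.singleton_subset_iff.mpr ?_)
      change ι₀ (ρ y₀) ∈ V
      rw [hρapp, hy₀, hξ']
      exact hξV
    · haveI : IsClosedImmersion (ρ ∣_ U) := by
        have i1 : IsClosedImmersion ((CategoryStruct.comp j σ) ∣_ V) := by
          rw [morphismRestrict_comp]
          haveI := hiso
          exact (MorphismProperty.cancel_right_of_respectsIso
            @AlgebraicGeometry.IsClosedImmersion _ _).mpr
            (IsZariskiLocalAtTarget.restrict (inferInstanceAs (IsClosedImmersion j)) _)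
        rw [← hρ, morphismRestrict_comp] at i1
        exact MorphismProperty.of_postcomp (W := @AlgebraicGeometry.IsClosedImmersion)
          (W' := @AlgebraicGeometry.IsSeparated) (ρ ∣_ U) (ι₀ ∣_ V) inferInstance i1
      haveI : AlgebraicGeometry.Surjective (ρ ∣_ U) := by
        refine ⟨fun u => ?_⟩
        have hu : ι₀ u.1 ∈ V := u.2
        obtain ⟨x, hx, -⟩ := L1 σ hiso hu
        have hxZ : x ∈ Set.range j := by
          rw [hrangej]
          exact hover x (hx ▸ Set.mem_range_self _) (hx ▸ hu)
        obtain ⟨y₁, rfl⟩ := hxZ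
        have hρy₁ : ρ y₁ = u.1 := ι₀.isClosedEmbedding.injective (by rw [hρapp, hx])
        refine ⟨⟨y₁, show ρ y₁ ∈ U by rw [hρy₁]; exact u.2⟩, Subtype.ext ?_⟩
        rw [morphismRestrict_base_coe]
        exact hρy₁
      exact isIso_of_isClosedImmersion_of_surjective _
  exact ⟨_, ρ, ⟨inferInstance, hbir, hreg⟩⟩

end Summit.ResolutionOfSingularities.ResolutionOfSingularities.Theses.EquisingularLift
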